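import Literature.LinearAlgebra.Matrix.HermitianCfcDiagonalForm
import HarnessLib

/-!
# Translation-invariant (convolution) matrices on a finite abelian group: they commute, their
# functions are translation-invariant, and the entries of a positive function of such a matrix
# are bounded by the normalised trace — with the eigenvalue comparison for a dominated pair

Topic `LinearAlgebra/Matrix`, namespace `Literature.LinearAlgebra.Matrix`.  A matrix `Q` indexed by
a finite abelian group `G` is *translation-invariant* (`G`-invariant, a convolution operator) if
`Q (x+a) (y+a) = Q x y` (Ceccherini-Silberstein–Scarabotti–Tolli, *Discrete Harmonic Analysis*,
CUP 2018, §2.4: Lemma 2.4.9 "`R` is `A`-invariant iff `r(x-z,y-z) = r(x,y)`"; Theorem 2.4.10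
"`A`-invariant ⟺ convolution operator ⟺ every character is an eigenvector"; Exercise 2.4.8(3):
the convolution operators form a COMMUTATIVE algebra; Corollary 2.4.12 (trace formula)
"`Tr(R_h) = Σ_χ ĥ(χ) = |A| h(0)`").  This file records the character-free consequences used by
lattice field theory on a torus (functions of a translation-invariant finite-range form, e.g. the
finite-range decomposition `C_j = g_j(Q)` of `FiniteRangeDecompositionMatrix.lean`):

* two translation-invariant matrices commute (substitution `z ↦ x + y - z` in `(QP)_{xy}`);
* `f(Q)` is translation-invariant when `Q` is (a symmetry of `Q` is a symmetry of `f(Q)`);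
* the diagonal of a translation-invariant matrix is constant, `tr M = |G| M_{00}`, hence for a
  positive semi-definite one `‖M_{xy}‖ ≤ M_{00} = |G|⁻¹ tr M`; for `M = f(Q)`, `f ≥ 0`:
  `‖f(Q)_{xy}‖ ≤ |G|⁻¹ Σ_k f(λ_k(Q))`;
* for a dominated commuting pair `P ≤ Q` (in particular two translation-invariant forms with
  `Q - P ⪰ 0`) and `g` antitone on `[0,∞)`, `P ⪰ 0`: `Σ_k g(λ_k(Q)) ≤ Σ_k g(λ_k(P))` — so the
  entries of `g(Q)` are controlled by the spectrum of the comparison form `P` alone (for `P` a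
  multiple of the lattice Laplacian: by explicit lattice sums).

## Contents (everything is proved; no definition and no named fact is introduced)

* `mul_apply_eq_of_translationInvariant`, **`commute_of_translationInvariant`**;
* `cfc_translationInvariant`; `apply_diag_eq_of_translationInvariant`,
  `trace_eq_card_mul_of_translationInvariant`;
* **`norm_apply_le_trace_div_card`**, **`norm_cfc_apply_le_sum_eigenvalues`**;
* **`sum_eigenvalues_le_of_commute`**, `sum_eigenvalues_le_of_translationInvariant`,
  `norm_cfc_apply_le_sum_eigenvalues_of_le`.

## References

* T. Ceccherini-Silberstein, F. Scarabotti, F. Tolli, *Discrete Harmonic Analysis* (CUP 2018),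
  §2.4 (Lemma 2.4.9, Theorem 2.4.10, Exercise 2.4.8, Corollaries 2.4.11–2.4.12).
  [CeccherinisilbersteScarabottiTolli2018]
* R. A. Horn, C. R. Johnson, *Matrix Analysis*, 2nd ed. (CUP 2013), Cor. 4.3.12. [HornJohnson2013]
-/

noncomputable section

open Matrix
open scoped MatrixOrder ComplexOrder

namespace Literature.LinearAlgebra.Matrix

variable {𝕜 : Type*} [RCLike 𝕜] {G : Type*} [AddCommGroup G] [Fintype G] [DecidableEq G]

/-! ### Translation-invariant matrices commute -/

omit [DecidableEq G] in
/-- The `(x,y)` entry of a product of translation-invariant matrices is symmetric in the factors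
(substitute `z ↦ x + y - z`). [cite: CeccherinisilbersteScarabottiTolli2018, §2.4, Exercise 2.4.8(3) (the convolution operators form a commutative algebra)] -/
theorem mul_apply_eq_of_translationInvariant {Q P : Matrix G G 𝕜}
    (hQ : ∀ a x y, Q (x + a) (y + a) = Q x y) (hP : ∀ a x y, P (x + a) (y + a) = P x y) (x y : G) :
    (Q * P) x y = (P * Q) x y := by
  rw [Matrix.mul_apply, Matrix.mul_apply]
  rw [← Equiv.sum_comp (Equiv.subLeft (x + y)) (fun z => Q x z * P z y)]
  refine Finset.sum_congr rfl fun z _ => ?_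
  simp only [Equiv.subLeft_apply]
  have h1 : Q x (x + y - z) = Q z y := by
    have := hQ (z - x) x (x + y - z)
    rw [show x + (z - x) = z by abel, show x + y - z + (z - x) = y by abel] at this
    exact this.symm
  have h2 : P (x + y - z) y = P x z := by
    have := hP (z - y) (x + y - z) y
    rw [show x + y - z + (z - y) = x by abel, show y + (z - y) = z by abel] at this
    exact this.symm
  rw [h1, h2, mul_comm]

omit [DecidableEq G] in
/-- **Translation-invariant matrices on a finite abelian group commute** (the convolution
algebra is commutative). [cite: CeccherinisilbersteScarabottiTolli2018, §2.4, Exercise 2.4.8(3) and Theorem 2.4.10] -/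
theorem commute_of_translationInvariant {Q P : Matrix G G 𝕜}
    (hQ : ∀ a x y, Q (x + a) (y + a) = Q x y) (hP : ∀ a x y, P (x + a) (y + a) = P x y) :
    Commute Q P :=
  Matrix.ext fun x y => mul_apply_eq_of_translationInvariant hQ hP x y

/-! ### Functions, diagonal and trace of a translation-invariant matrix -/

/-- **A function of a translation-invariant Hermitian matrix is translation-invariant.**
[cite: CeccherinisilbersteScarabottiTolli2018, §2.4, Theorem 2.4.10 (A-invariant operators form an algebra containing its spectral functions)] -/
theorem cfc_translationInvariant {Q : Matrix G G 𝕜} (hQ : Q.IsHermitian)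
    (hQt : ∀ a x y, Q (x + a) (y + a) = Q x y) (f : ℝ → ℝ) (a x y : G) :
    cfc f Q (x + a) (y + a) = cfc f Q x y :=
  cfc_apply_equiv_of_invariant hQ (Equiv.addRight a) (fun u v => hQt a u v) f x y

omit [RCLike 𝕜] [Fintype G] [DecidableEq G] in
/-- The diagonal of a translation-invariant matrix is constant: `M_{xx} = M_{00}`.
[cite: CeccherinisilbersteScarabottiTolli2018, §2.4, Lemma 2.4.9 (r(x,y) = h(x-y))] -/
theorem apply_diag_eq_of_translationInvariant {M : Matrix G G 𝕜}
    (hM : ∀ a x y, M (x + a) (y + a) = M x y) (x : G) : M x x = M 0 0 := by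
  have := hM x 0 0
  rwa [zero_add] at this

omit [DecidableEq G] in
/-- **Trace formula**: `tr M = |G| · M_{00}` for a translation-invariant `M`.
[cite: CeccherinisilbersteScarabottiTolli2018, §2.4, Corollary 2.4.12 (Tr(R_h) = |A| h(0))] -/
theorem trace_eq_card_mul_of_translationInvariant {M : Matrix G G 𝕜}
    (hM : ∀ a x y, M (x + a) (y + a) = M x y) : trace M = (Fintype.card G : 𝕜) * M 0 0 := by
  rw [Matrix.trace]
  simp_rw [Matrix.diag_apply, fun x => apply_diag_eq_of_translationInvariant hM x]
  rw [Finset.sum_const, Finset.card_univ, nsmul_eq_mul]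

/-! ### Entry bounds by the normalised trace -/

/-- **Entries of a positive semi-definite translation-invariant matrix are bounded by the
normalised trace**: `‖M_{xy}‖ ≤ re M_{00} = |G|⁻¹ re(tr M)` (the `2×2` minor test and the
constant diagonal). [cite: CeccherinisilbersteScarabottiTolli2018, §2.4, Corollary 2.4.12 (trace formula)] -/
theorem norm_apply_le_trace_div_card {M : Matrix G G 𝕜} (hM : M.PosSemidef)
    (hMt : ∀ a x y, M (x + a) (y + a) = M x y) (x y : G) :
    ‖M x y‖ ≤ (Fintype.card G : ℝ)⁻¹ * RCLike.re (trace M) := by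
  have h := norm_apply_le_of_posSemidef hM x y
  rw [apply_diag_eq_of_translationInvariant hMt x, apply_diag_eq_of_translationInvariant hMt y]
    at h
  have hcard : (0 : ℝ) < Fintype.card G := by
    have : Nonempty G := ⟨x⟩
    exact_mod_cast Fintype.card_pos
  have hre : RCLike.re (trace M) = (Fintype.card G : ℝ) * RCLike.re (M 0 0) := by
    rw [trace_eq_card_mul_of_translationInvariant hMt, ← RCLike.ofReal_natCast,
      RCLike.re_ofReal_mul]
  rw [hre, ← mul_assoc, inv_mul_cancel₀ hcard.ne', one_mul]
  linarith

/-- **Entries of a nonnegative function of a translation-invariant Hermitian matrix are bounded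
by the normalised spectral sum**: `‖f(Q)_{xy}‖ ≤ |G|⁻¹ Σ_k f(λ_k(Q))` for `f ≥ 0` on the
spectrum. [cite: CeccherinisilbersteScarabottiTolli2018, §2.4, Corollaries 2.4.11–2.4.12 (spectrum and trace of a convolution operator)] -/
theorem norm_cfc_apply_le_sum_eigenvalues {Q : Matrix G G 𝕜} (hQ : Q.IsHermitian)
    (hQt : ∀ a x y, Q (x + a) (y + a) = Q x y) {f : ℝ → ℝ}
    (hf : ∀ μ ∈ spectrum ℝ Q, 0 ≤ f μ) (x y : G) :
    ‖cfc f Q x y‖ ≤ (Fintype.card G : ℝ)⁻¹ * ∑ k, f (hQ.eigenvalues k) := by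
  have hpsd : (cfc f Q).PosSemidef := Matrix.nonneg_iff_posSemidef.mp (cfc_nonneg hf)
  have ht : ∀ a x y, cfc f Q (x + a) (y + a) = cfc f Q x y := cfc_translationInvariant hQ hQt f
  have h := norm_apply_le_trace_div_card hpsd ht x y
  rwa [trace_cfc_eq_sum_eigenvalues hQ f, RCLike.ofReal_re] at h

/-! ### Comparison of spectral sums for a dominated commuting pair -/

omit [AddCommGroup G] in
/-- `V* (V D V*) V = D` for `V` unitary. [folklore] -/
theorem star_mul_conj_mul_eq {V : Matrix G G 𝕜} (hV : V ∈ Matrix.unitaryGroup G 𝕜)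
    (D : Matrix G G 𝕜) : star V * (V * D * star V) * V = D := by
  have h1 : star V * V = 1 := Unitary.star_mul_self_of_mem hV
  calc star V * (V * D * star V) * V = (star V * V) * D * (star V * V) := by
        simp only [Matrix.mul_assoc]
    _ = D := by rw [h1, Matrix.one_mul, Matrix.mul_one]

omit [AddCommGroup G] in
/-- **Spectral sums of an antitone function decrease along a dominated commuting pair**: for
commuting Hermitian `Q, P` with `Q - P ⪰ 0`, `P ⪰ 0`, and `g` antitone on `[0,∞)`,
`Σ_k g(λ_k(Q)) ≤ Σ_k g(λ_k(P))` (Mathlib's eigenvalue enumerations on both sides; proof through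
the ordered joint diagonalisation, the enumerations being irrelevant for a sum).
[cite: HornJohnson2013, Cor. 4.3.12 (Weyl monotonicity), commuting case] -/
theorem sum_eigenvalues_le_of_commute {Q P : Matrix G G 𝕜} (hQ : Q.IsHermitian)
    (hP : P.IsHermitian) (hc : Commute Q P) (hle : (Q - P).PosSemidef) (hPpsd : P.PosSemidef)
    {g : ℝ → ℝ} (hg : AntitoneOn g (Set.Ici 0)) :
    ∑ k, g (hQ.eigenvalues k) ≤ ∑ k, g (hP.eigenvalues k) := by
  obtain ⟨V, hV, μQ, μP, hQV, hPV, hμ⟩ := exists_joint_diagonal_le hQ hP hc hle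
  have hμP : ∀ k, 0 ≤ μP k := by
    intro k
    have h := re_conj_apply_nonneg_of_posSemidef hPpsd V k
    rw [hPV, star_mul_conj_mul_eq hV, diagonal_apply_eq, RCLike.ofReal_re] at h
    exact h
  have hμQ : ∀ k, 0 ≤ μQ k := fun k => (hμP k).trans (hμ k)
  have e1 : ∑ k, g (hQ.eigenvalues k) = ∑ k, g (μQ k) := by
    have h1 : ((∑ k, g (hQ.eigenvalues k) : ℝ) : 𝕜) = ((∑ k, g (μQ k) : ℝ) : 𝕜) := by
      rw [← trace_cfc_eq_sum_eigenvalues hQ g, trace_cfc_eq_sum hV hQV g]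
    exact_mod_cast h1
  have e2 : ∑ k, g (hP.eigenvalues k) = ∑ k, g (μP k) := by
    have h2 : ((∑ k, g (hP.eigenvalues k) : ℝ) : 𝕜) = ((∑ k, g (μP k) : ℝ) : 𝕜) := by
      rw [← trace_cfc_eq_sum_eigenvalues hP g, trace_cfc_eq_sum hV hPV g]
    exact_mod_cast h2
  rw [e1, e2]
  exact sum_antitone_le_of_le hμ hg (fun k => Set.mem_Ici.mpr (hμQ k))
    (fun k => Set.mem_Ici.mpr (hμP k))

/-- The translation-invariant case: two translation-invariant Hermitian forms with `Q - P ⪰ 0`,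
`P ⪰ 0` satisfy `Σ_k g(λ_k(Q)) ≤ Σ_k g(λ_k(P))` for `g` antitone on `[0,∞)`.
[cite: CeccherinisilbersteScarabottiTolli2018, §2.4, Theorem 2.4.10 and Corollary 2.4.11 (common eigenbasis of characters)] -/
theorem sum_eigenvalues_le_of_translationInvariant {Q P : Matrix G G 𝕜} (hQ : Q.IsHermitian)
    (hP : P.IsHermitian) (hQt : ∀ a x y, Q (x + a) (y + a) = Q x y)
    (hPt : ∀ a x y, P (x + a) (y + a) = P x y) (hle : (Q - P).PosSemidef) (hPpsd : P.PosSemidef)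
    {g : ℝ → ℝ} (hg : AntitoneOn g (Set.Ici 0)) :
    ∑ k, g (hQ.eigenvalues k) ≤ ∑ k, g (hP.eigenvalues k) :=
  sum_eigenvalues_le_of_commute hQ hP (commute_of_translationInvariant hQt hPt) hle hPpsd hg

/-- **The working bound**: for translation-invariant Hermitian `Q ⪰ P ⪰ 0`, a function `f` with
`0 ≤ f ≤ g` on `[0,∞)` and `g` antitone there,
`‖f(Q)_{xy}‖ ≤ |G|⁻¹ Σ_k g(λ_k(P))` — the entries of `f(Q)` are controlled by the spectrum of
the comparison form alone. [cite: CeccherinisilbersteScarabottiTolli2018, §2.4, Corollaries 2.4.11–2.4.12] -/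
theorem norm_cfc_apply_le_sum_eigenvalues_of_le {Q P : Matrix G G 𝕜} (hQ : Q.IsHermitian)
    (hP : P.IsHermitian) (hQt : ∀ a x y, Q (x + a) (y + a) = Q x y)
    (hPt : ∀ a x y, P (x + a) (y + a) = P x y) (hle : (Q - P).PosSemidef) (hPpsd : P.PosSemidef)
    {f g : ℝ → ℝ} (hf0 : ∀ μ, 0 ≤ μ → 0 ≤ f μ) (hfg : ∀ μ, 0 ≤ μ → f μ ≤ g μ)
    (hg : AntitoneOn g (Set.Ici 0)) (x y : G) :
    ‖cfc f Q x y‖ ≤ (Fintype.card G : ℝ)⁻¹ * ∑ k, g (hP.eigenvalues k) := by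
  have hQpsd : Q.PosSemidef := by
    have : Q = (Q - P) + P := by abel
    rw [this]
    exact hle.add hPpsd
  have hspec : ∀ μ ∈ spectrum ℝ Q, 0 ≤ μ := fun μ hμ =>
    spectrum_nonneg_of_nonneg (Matrix.nonneg_iff_posSemidef.mpr hQpsd) hμ
  have hev : ∀ k, 0 ≤ hQ.eigenvalues k := fun k => by
    apply hspec
    rw [hQ.spectrum_real_eq_range_eigenvalues]
    exact Set.mem_range_self k
  refine (norm_cfc_apply_le_sum_eigenvalues hQ hQt (fun μ hμ => hf0 μ (hspec μ hμ)) x y).trans ?_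
  have hcard : (0 : ℝ) ≤ (Fintype.card G : ℝ)⁻¹ := by positivity
  refine mul_le_mul_of_nonneg_left ?_ hcard
  exact (Finset.sum_le_sum fun k _ => hfg _ (hev k)).trans
    (sum_eigenvalues_le_of_translationInvariant hQ hP hQt hPt hle hPpsd hg)

end Literature.LinearAlgebra.Matrix

end
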